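/-
Copyright (c) 2026 the pub-hodgecm-mathlib formalisation cell (harness21).  Prover seat hodgecm-mathlib-A-p12 (g35): P6b wave A seat 1 «FFGS-QUOT» (A), §B
«INTEGRALITY ∕ FINITENESS OVER THE INVARIANTS» (dealer desk F0P6b-plan (g13) DEAL P6b-A1, director g34 s1734; box F0P6-ref1 (g8)), 2026-09-03.
-/
import Literature.AlgebraicGeometry.GroupSchemes.FiniteFlatGroupSchemeQuotientAffineTwist
import Mathlib.RingTheory.IntegralClosure.IsIntegralClosure.Basic
import Mathlib.RingTheory.Adjoin.Tower
import Mathlib.Algebra.Polynomial.Lifts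
import HarnessLib

/-!
# Quotient of an affine scheme by a finite locally free group scheme, §B: the ring is integral (finite) over the invariants

Topic `AlgebraicGeometry/GroupSchemes`; namespace `Literature.AlgebraicGeometry.GroupSchemes.FiniteFlatQuotientAffine` (sub-namespace = the object:
the affine quotient `X ⧸ Z = Spec C₀` of [MumfordAV1970] §12 Thm. 1 ∕ [SGA3I] Exp. V Thm. 4.1 ∕ [StacksProject] Tag 03BM); THEOREMS ONLY (no definition,
instance, notation or named fact); Mathlib-footed, over §A (`…QuotientAffineTwist`: the Galois twist, `charpoly_lmul_map`).  Cell `pub/hodgecm-mathlib`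
(D-0151), organ «FFGS-QUOT» (A) (desk F0P6b-plan (g13) sheet §0; signature sheet `WAVEA-SIGNATURES.v2` `sig_FFGSQ_A_torsorOverInvariants` conjunct 1 +
`sig_FFGSQ_A4_finiteType_invariants`), lane `--supports stmt-HodgeConjecture-24832`; count-neutral (banked Row-4B capital).  HC_CM is proved only modulo the
printed citations (2 remaining named inputs hLiu418 = `stmt-HodgeConjecture-24832`, h413 = `stmt-HodgeConjecture-24833`) until rung 0 closes.

THE SETTING (ring form, Mathlib currency, the signature sheet VERBATIM).  `R` a commutative ring, `H` a COMMUTATIVE Hopf algebra over `R`, FINITE FREE as an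
`R`-module (the finite locally free case is reduced to this one in §E); `C` a commutative `R`-algebra (`Spec C = X`) with a right COACTION
`ρ : C →ₐ[R] C ⊗[R] H` (the action `X × Z → X`), coassociative and counital in the element-wise form
`hcoassoc : ∀ c, map id comul (ρ c) = assoc (map ρ id (ρ c))`, `hcounit : ∀ c, rid (map id counit (ρ c)) = c`.
The INVARIANTS are `C₀ := AlgHom.equalizer ρ includeLeft = {c | ρ c = c ⊗ 1}` (an `R`-subalgebra of `C`; `Spec C₀ = X ⧸ Z`).  NO freeness of the action is
used in this file.

THE RESULTS.
* `coeff_charpoly_coaction_mem_equalizer` — the characteristic polynomial `χ_c ∈ C[X]` of left multiplication by `ρ c` on the free `C`-module `C ⊗[R] H` has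
  all its coefficients in `C₀` ([MumfordAV1970] §12, proof of Thm. 1 p. 112; [StacksProject] Tag 03BH «`Norm_{s♯}(t♯ f) ∈ C₀`» for every coefficient):
  `χ_c.map ρ = χ_c.map includeLeft` (`charpoly_coaction_map_eq`) because both are characteristic polynomials over `D = C ⊗ H` (§A `charpoly_lmul_map`) of
  left multiplications by `(ρ ⊗ id)(ρ c)` resp. `(includeLeft ⊗ id)(ρ c)`, which are CONJUGATE under the Galois twist of §A (`galoisTwist_map_includeLeft`:
  `T ∘ (includeLeft ⊗ id) = assoc⁻¹ ∘ (id ⊗ Δ)`, then `hcoassoc`; Mathlib `LinearEquiv.charpoly_conj`).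
* `aeval_charpoly_coaction` — `χ_c (c) = 0` (Cayley–Hamilton `LinearMap.aeval_self_charpoly` gives `χ_c (ρ c) = 0` in `C ⊗ H`; apply the `C`-algebra map
  `ε_C = rid ∘ (id ⊗ ε)` and `hcounit`; [StacksProject] Tag 03BJ).
* `isIntegral_invariants`, `algebraIsIntegral_invariants` — **`C` is integral over `C₀`** ([StacksProject] Tag 03BJ; [SGA3I] V 4.1; [MumfordAV1970] §12 Thm. 1).
* `finite_invariants` — `C` of finite type over `R` ⇒ **`Module.Finite C₀ C`** = conjunct 1 of «FFGS-QUOT» (A) ([MumfordAV1970] §12 Thm. 1 (A) «`π` is finite»;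
  the finite-type hypothesis is the organ's declared budget, all P6b consumers being of finite type).
* `finiteType_invariants` — `R` Noetherian ⇒ **`Algebra.FiniteType R C₀`** = (A4) ([MumfordAV1970] §12 Thm. 1 (A) «`Y` of finite type»; Artin–Tate, Mathlib
  `fg_of_fg_of_fg`).

NOT HERE (later §§, same namespace): the basis ∕ torsor criterion (§C, Tag 03C8), the local general-position step over an infinite residue field (§D),
and the assembled (A) «`C` faithfully flat over `C₀`, `ker (includeLeft ⊗ ρ) = ⟨c ⊗ 1 − 1 ⊗ c⟩`» for `H` finite flat over Noetherian `R` (§E, Tag 03BM).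

## References
* [MumfordAV1970] D. Mumford, *Abelian Varieties* (1970), §12 «Quotients by finite group schemes», Thm. 1 (A) and its proof pp. 111–115.
* [SGA3I] M. Demazure, A. Grothendieck (eds.), *SGA 3, Tome I*, Exp. V, Thm. 4.1 (i) (`p : X → Y` entier).
* [StacksProject] The Stacks Project, Tags 03BH (the norm lands in the invariants), 03BJ (integrality over the invariants), 03BM (the affine quotient).
-/

set_option autoImplicit false

namespace Literature.AlgebraicGeometry.GroupSchemes.FiniteFlatQuotientAffine

open TensorProduct Algebra.TensorProduct WithConv

section Integral

variable {R : Type*} [CommRing R] {H : Type*} [CommRing H] [HopfAlgebra R H]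
  {C : Type*} [CommRing C] [Algebra R C] (ρ : C →ₐ[R] C ⊗[R] H)

/-! ## §B.3  Integrality of `C` over the invariants `C₀ = AlgHom.equalizer ρ includeLeft` -/

/-- The Galois twist of `D ⊗ H`, `D = C ⊗[R] H`, `j = includeRight`, carries `includeLeft ⊗ id` to `id ⊗ Δ`: `T ((c ⊗ g) ⊗ 1-leg) = Σ (c ⊗ g₁) ⊗ g₂`, i.e.
`T ∘ (includeLeft ⊗ id) = assoc⁻¹ ∘ (id ⊗ Δ)` on `C ⊗[R] H` (the shear of [StacksProject] Tag 03BI carries `s ⊗ 1` to the composition leg `c♯ = id ⊗ Δ`,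
cf. the diagram of Tag 03BH's proof). [cite: StacksProject, Tag 03BH] -/
theorem galoisTwist_map_includeLeft (y : C ⊗[R] H) :
    productMap (includeLeft : C ⊗[R] H →ₐ[R] (C ⊗[R] H) ⊗[R] H)
        ((Algebra.TensorProduct.map (includeRight : H →ₐ[R] C ⊗[R] H) (AlgHom.id R H)).comp
          (Bialgebra.comulAlgHom R H))
      (Algebra.TensorProduct.map (includeLeft : C →ₐ[R] C ⊗[R] H) (AlgHom.id R H) y) =
    (TensorProduct.assoc R C H H).symm
      (TensorProduct.map LinearMap.id (Coalgebra.comul (R := R) (A := H)) y) := by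
  induction y using TensorProduct.induction_on with
  | zero => simp
  | tmul c g =>
      have hg := (Coalgebra.Repr.arbitrary R g).eq
      simp only [Algebra.TensorProduct.map_tmul, AlgHom.id_apply, productMap_apply_tmul, AlgHom.comp_apply,
        Bialgebra.comulAlgHom_apply, TensorProduct.map_tmul, LinearMap.id_apply, ← hg, map_sum,
        tmul_sum, Finset.mul_sum, Algebra.TensorProduct.includeLeft_apply,
        Algebra.TensorProduct.includeRight_apply, Algebra.TensorProduct.tmul_mul_tmul, mul_one, one_mul,
        TensorProduct.assoc_symm_tmul]
  | add x y hx hy => simp only [map_add, hx, hy]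

variable [Module.Free R H] [Module.Finite R H]

/-- **`χ_c.map ρ = χ_c.map includeLeft`** for the characteristic polynomial `χ_c` of left multiplication by `ρ c` on `C ⊗[R] H` over `C` (coassociative
coaction, `H` finite free): both sides are characteristic polynomials over `D = C ⊗ H` of left multiplications (`charpoly_lmul_map`) by `ι_ρ (ρ c)` resp.
`ι₁ (ρ c)`, and these are conjugate under the Galois twist (`galoisTwist_map_includeLeft` + `hcoassoc`, Mathlib `LinearEquiv.charpoly_conj`).  This is
«`s♯ (Norm_{s♯} (t♯ f)) = t♯ (Norm_{s♯} (t♯ f))`» of [StacksProject] Tag 03BH for all coefficients at once. [cite: StacksProject, Tag 03BH] -/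
theorem charpoly_coaction_map_eq
    (hcoassoc : ∀ c : C, TensorProduct.map LinearMap.id (Coalgebra.comul (R := R) (A := H)) (ρ c) =
      TensorProduct.assoc R C H H (TensorProduct.map ρ.toLinearMap LinearMap.id (ρ c)))
    (c : C) :
    ((Algebra.lmul C (C ⊗[R] H) (ρ c)).charpoly).map (ρ : C →+* C ⊗[R] H) =
      ((Algebra.lmul C (C ⊗[R] H) (ρ c)).charpoly).map
        ((includeLeft : C →ₐ[R] C ⊗[R] H) : C →+* C ⊗[R] H) := by
  rw [charpoly_lmul_map ρ, charpoly_lmul_map (includeLeft : C →ₐ[R] C ⊗[R] H)]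
  set T := productMap (includeLeft : C ⊗[R] H →ₐ[R] (C ⊗[R] H) ⊗[R] H)
        ((Algebra.TensorProduct.map (includeRight : H →ₐ[R] C ⊗[R] H) (AlgHom.id R H)).comp
          (Bialgebra.comulAlgHom R H)) with hT
  have hTx : T (Algebra.TensorProduct.map (includeLeft : C →ₐ[R] C ⊗[R] H) (AlgHom.id R H) (ρ c)) =
      Algebra.TensorProduct.map ρ (AlgHom.id R H) (ρ c) := by
    rw [hT, galoisTwist_map_includeLeft, hcoassoc c, LinearEquiv.symm_apply_apply]
    rfl
  let e : ((C ⊗[R] H) ⊗[R] H) ≃ₗ[C ⊗[R] H] ((C ⊗[R] H) ⊗[R] H) :=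
    LinearEquiv.ofBijective
      ({ toFun := T, map_add' := map_add T,
         map_smul' := galoisTwist_smul (includeRight : H →ₐ[R] C ⊗[R] H) } :
        ((C ⊗[R] H) ⊗[R] H) →ₗ[C ⊗[R] H] ((C ⊗[R] H) ⊗[R] H))
      (galoisTwist_bijective (includeRight : H →ₐ[R] C ⊗[R] H))
  have he : ∀ z, e z = T z := fun z => rfl
  have hconj : e.conj (Algebra.lmul (C ⊗[R] H) ((C ⊗[R] H) ⊗[R] H)
      (Algebra.TensorProduct.map (includeLeft : C →ₐ[R] C ⊗[R] H) (AlgHom.id R H) (ρ c))) =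
      Algebra.lmul (C ⊗[R] H) ((C ⊗[R] H) ⊗[R] H) (Algebra.TensorProduct.map ρ (AlgHom.id R H) (ρ c)) := by
    apply LinearMap.ext
    intro z
    simp only [LinearEquiv.conj_apply, LinearMap.comp_apply, LinearEquiv.coe_coe, Algebra.coe_lmul_eq_mul,
      LinearMap.mul_apply']
    rw [he, map_mul, hTx, ← he, LinearEquiv.apply_symm_apply]
  rw [← hconj, LinearEquiv.charpoly_conj]

/-- **The coefficients of `χ_c` are invariant**: `(charpoly (lmul (ρ c))).coeff k ∈ AlgHom.equalizer ρ includeLeft` ([MumfordAV1970] §12, proof of Thm. 1,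
p. 112: «the coefficients of the characteristic polynomial are `G`-invariant»). [cite: MumfordAV1970, §12 Thm. 1 proof p. 112] -/
theorem coeff_charpoly_coaction_mem_equalizer
    (hcoassoc : ∀ c : C, TensorProduct.map LinearMap.id (Coalgebra.comul (R := R) (A := H)) (ρ c) =
      TensorProduct.assoc R C H H (TensorProduct.map ρ.toLinearMap LinearMap.id (ρ c)))
    (c : C) (k : ℕ) :
    ((Algebra.lmul C (C ⊗[R] H) (ρ c)).charpoly).coeff k ∈
      AlgHom.equalizer ρ (includeLeft : C →ₐ[R] C ⊗[R] H) := by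
  rw [AlgHom.mem_equalizer]
  have h := congr_arg (fun p => Polynomial.coeff p k) (charpoly_coaction_map_eq ρ hcoassoc c)
  simpa only [Polynomial.coeff_map, RingHom.coe_coe] using h

omit [Module.Free R H] [Module.Finite R H] in
/-- The `C`-algebra map `ε_C := rid ∘ (id ⊗ ε) : C ⊗[R] H → C` (the unit section `e : X → X × Z` of the groupoid, [StacksProject] Tag 03BH diagram)
agrees with the linear-map form `rid (map id counit y)` used in the signature sheet's `hcounit`. [cite: StacksProject, Tag 03BH] -/
theorem rid_comp_map_counit_apply (y : C ⊗[R] H) :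
    (Algebra.TensorProduct.rid R C C).toAlgHom.comp
        (Algebra.TensorProduct.map (AlgHom.id C C) (Bialgebra.counitAlgHom R H)) y =
      TensorProduct.rid R C (TensorProduct.map LinearMap.id (Coalgebra.counit (R := R) (A := H)) y) := by
  induction y using TensorProduct.induction_on with
  | zero => simp
  | tmul c g => simp [Algebra.TensorProduct.map_tmul, TensorProduct.rid_tmul, Algebra.TensorProduct.rid_tmul]
  | add x y hx hy => simp only [map_add, hx, hy]

/-- **Cayley–Hamilton through the counit: `χ_c (c) = 0`.**  `χ_c (lmul (ρ c)) = 0` on `C ⊗[R] H` (Mathlib `LinearMap.aeval_self_charpoly`), hence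
`χ_c (ρ c) = 0` in `C ⊗ H`, and applying the `C`-algebra map `ε_C` with `ε_C (ρ c) = c` (`hcounit`) gives `χ_c (c) = 0` in `C` ([StacksProject] Tag 03BJ:
«`P (f) = 0` by Cayley–Hamilton»; there one divides by the faithfully flat `t`, here the counit section does it). [cite: StacksProject, Tag 03BJ] -/
theorem aeval_charpoly_coaction
    (hcounit : ∀ c : C, TensorProduct.rid R C
      (TensorProduct.map LinearMap.id (Coalgebra.counit (R := R) (A := H)) (ρ c)) = c)
    (c : C) : Polynomial.aeval c ((Algebra.lmul C (C ⊗[R] H) (ρ c)).charpoly) = 0 := by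
  set εC : C ⊗[R] H →ₐ[C] C := (Algebra.TensorProduct.rid R C C).toAlgHom.comp
      (Algebra.TensorProduct.map (AlgHom.id C C) (Bialgebra.counitAlgHom R H)) with hεC
  have h1 : εC (ρ c) = c := by rw [hεC, rid_comp_map_counit_apply, hcounit]
  have h2 : Polynomial.aeval (ρ c) ((Algebra.lmul C (C ⊗[R] H) (ρ c)).charpoly) = 0 := by
    have hCH := LinearMap.aeval_self_charpoly (Algebra.lmul C (C ⊗[R] H) (ρ c))
    rw [Polynomial.aeval_algHom_apply] at hCH
    have h3 := congr_arg (fun φ : Module.End C (C ⊗[R] H) => φ 1) hCH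
    simpa only [Algebra.coe_lmul_eq_mul, LinearMap.mul_apply', mul_one, LinearMap.zero_apply] using h3
  have h4 := Polynomial.aeval_algHom_apply εC (ρ c) ((Algebra.lmul C (C ⊗[R] H) (ρ c)).charpoly)
  rw [h1] at h4
  rw [h4, h2, map_zero]

/-- **Every element of `C` is integral over the invariants `C₀ = AlgHom.equalizer ρ includeLeft`** (coassociative counital coaction of a finite free
commutative Hopf algebra; NO freeness of the action): `c` is a root of the monic `χ_c ∈ C₀[X]` ([StacksProject] Tag 03BJ «`A` is integral over `C`»;
[MumfordAV1970] §12 Thm. 1 proof; [SGA3I] V 4.1 (i)). [cite: StacksProject, Tag 03BJ] -/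
theorem isIntegral_invariants
    (hcoassoc : ∀ c : C, TensorProduct.map LinearMap.id (Coalgebra.comul (R := R) (A := H)) (ρ c) =
      TensorProduct.assoc R C H H (TensorProduct.map ρ.toLinearMap LinearMap.id (ρ c)))
    (hcounit : ∀ c : C, TensorProduct.rid R C
      (TensorProduct.map LinearMap.id (Coalgebra.counit (R := R) (A := H)) (ρ c)) = c)
    (c : C) : IsIntegral (AlgHom.equalizer ρ (includeLeft : C →ₐ[R] C ⊗[R] H)) c := by
  set C₀ := AlgHom.equalizer ρ (includeLeft : C →ₐ[R] C ⊗[R] H) with hC₀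
  set χ := (Algebra.lmul C (C ⊗[R] H) (ρ c)).charpoly with hχ
  have hlifts : χ ∈ Polynomial.lifts (algebraMap C₀ C) := by
    rw [Polynomial.lifts_iff_coeff_lifts]
    intro k
    exact ⟨⟨χ.coeff k, coeff_charpoly_coaction_mem_equalizer ρ hcoassoc c k⟩, rfl⟩
  obtain ⟨q, hqχ, -, hqmonic⟩ :=
    Polynomial.lifts_and_natDegree_eq_and_monic hlifts (LinearMap.charpoly_monic _)
  refine ⟨q, hqmonic, ?_⟩
  rw [← Polynomial.eval_map, hqχ, ← Polynomial.coe_aeval_eq_eval]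
  exact aeval_charpoly_coaction ρ hcounit c

/-- `Algebra.IsIntegral C₀ C` for the invariants `C₀` of a coassociative counital coaction of a finite free commutative Hopf algebra (class form of
`isIntegral_invariants`; a THEOREM, not an instance). [cite: StacksProject, Tag 03BJ] -/
theorem algebraIsIntegral_invariants
    (hcoassoc : ∀ c : C, TensorProduct.map LinearMap.id (Coalgebra.comul (R := R) (A := H)) (ρ c) =
      TensorProduct.assoc R C H H (TensorProduct.map ρ.toLinearMap LinearMap.id (ρ c)))
    (hcounit : ∀ c : C, TensorProduct.rid R C
      (TensorProduct.map LinearMap.id (Coalgebra.counit (R := R) (A := H)) (ρ c)) = c) :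
    Algebra.IsIntegral (AlgHom.equalizer ρ (includeLeft : C →ₐ[R] C ⊗[R] H)) C :=
  ⟨fun c => isIntegral_invariants ρ hcoassoc hcounit c⟩

/-! ## §B.4  Finiteness: conjunct 1 of «FFGS-QUOT» (A) and (A4) -/

/-- **`C` is a finite `C₀`-module** when `C` is of finite type over `R` (conjunct 1 of [MumfordAV1970] §12 Thm. 1 (A) «`X → Y` is finite»; integral + finite
type ⇒ finite, Mathlib `Algebra.IsIntegral.finite`).  The finite-type hypothesis is the organ's declared budget (all P6b consumers are of finite type).
[cite: MumfordAV1970, §12 Thm. 1 (A) p. 111] -/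
theorem finite_invariants [Algebra.FiniteType R C]
    (hcoassoc : ∀ c : C, TensorProduct.map LinearMap.id (Coalgebra.comul (R := R) (A := H)) (ρ c) =
      TensorProduct.assoc R C H H (TensorProduct.map ρ.toLinearMap LinearMap.id (ρ c)))
    (hcounit : ∀ c : C, TensorProduct.rid R C
      (TensorProduct.map LinearMap.id (Coalgebra.counit (R := R) (A := H)) (ρ c)) = c) :
    Module.Finite (AlgHom.equalizer ρ (includeLeft : C →ₐ[R] C ⊗[R] H)) C := by
  haveI := algebraIsIntegral_invariants ρ hcoassoc hcounit
  haveI : Algebra.FiniteType (AlgHom.equalizer ρ (includeLeft : C →ₐ[R] C ⊗[R] H)) C :=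
    Algebra.FiniteType.of_restrictScalars_finiteType R _ C
  exact Algebra.IsIntegral.finite

/-- **(A4) The quotient is of finite type**: `R` Noetherian and `C` of finite type over `R` ⇒ `C₀` of finite type over `R` ([MumfordAV1970] §12 Thm. 1 (A)
«`Y` is of finite type»; E. Noether ∕ Artin–Tate, Mathlib `fg_of_fg_of_fg` applied to `R ⊆ C₀ ⊆ C` with `C` finite over `C₀`). [cite: MumfordAV1970, §12 Thm. 1 (A) p. 111] -/
theorem finiteType_invariants [IsNoetherianRing R] [Algebra.FiniteType R C]
    (hcoassoc : ∀ c : C, TensorProduct.map LinearMap.id (Coalgebra.comul (R := R) (A := H)) (ρ c) =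
      TensorProduct.assoc R C H H (TensorProduct.map ρ.toLinearMap LinearMap.id (ρ c)))
    (hcounit : ∀ c : C, TensorProduct.rid R C
      (TensorProduct.map LinearMap.id (Coalgebra.counit (R := R) (A := H)) (ρ c)) = c) :
    Algebra.FiniteType R (AlgHom.equalizer ρ (includeLeft : C →ₐ[R] C ⊗[R] H)) := by
  haveI := finite_invariants ρ hcoassoc hcounit
  refine ⟨fg_of_fg_of_fg R (AlgHom.equalizer ρ (includeLeft : C →ₐ[R] C ⊗[R] H)) C
    Algebra.FiniteType.out Module.Finite.fg_top ?_⟩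
  exact Subtype.val_injective

end Integral

end Literature.AlgebraicGeometry.GroupSchemes.FiniteFlatQuotientAffine
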